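import Literature.Algebra.EuclideanLattices.GaussianLatticeSums
import Literature.Algebra.EuclideanLattices.PQCDiscreteGaussian
import Mathlib.Analysis.Real.Pi.Bounds
import Mathlib.Analysis.Complex.ExponentialBounds
import HarnessLib

/-!
# Banaszczyk's tail bound for lattice Gaussians (Lemma 1.5), Aharonov–Regev Lemma 3.1, and the discharge of `gaussianMass_diff_ball_le_pow_mul`

Topic `Algebra/EuclideanLattices` (family `pqc`), sequel of `GaussianLatticeSums.lean` (the
shifted Poisson identity `∑_{y ∈ L} ρ_s(y - x) = vol(L)⁻¹ sⁿ ∑_{w ∈ L*} ρ_{1/s}(w) cos(2π⟪x, w⟫)`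
and its consequences `ρ_{ts}(L - x) ≤ tⁿ ρ_s(L)`). Everything is PROVED. Notation as there:
`ρ_s = gaussianFunction s`, `n = finrank ℝ V`.

## Results

* `tsum_indicator_gaussianFunction_sub_le` — **Banaszczyk 1993, Lemma 1.5** (shifted form, any
  `s > 0`): for `c ≥ 1/√(2π)` and any `x`,
  `∑_{y ∈ L, ‖y - x‖ ≥ c s √n} ρ_s(y - x) ≤ (c√(2πe) e^{-πc²})ⁿ ρ_s(L)`. This is Aharonov–Regev
  2005, Lemma 2.5 (= Banaszczyk's (ii) relative to `ρ(L)`; the printed factor `2` is not needed by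
  this proof) and, at `x = 0`, Micciancio–Regev 2007, Lemma 2.10
  (`tsum_indicator_gaussianFunction_le`).
* `tsum_gaussianFunction_sub_le_pow_mul_of_forall_le` — **Aharonov–Regev 2005, Lemma 3.1**: if
  `dist(x, L) ≥ c s √n` then `ρ_s(L - x) ≤ (c√(2πe) e^{-πc²})ⁿ ρ_s(L)`, i.e.
  `f(x) = ρ(L - x)/ρ(L) ≤ 2^{-Ω(n)}` as soon as `c > 1/√(2π)` (the base is then `< 1`).
* DISCHARGES (D-0014) of the two named facts of `PQCDiscreteGaussian.lean`:
  `gaussianMass_diff_ball_le_pow_mul_holds` — `ρ_s(L ∖ c s √n B) ≤ (c√(2πe) e^{-πc²})ⁿ ρ_s(L)` in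
  the `gaussianMass` (`ℝ≥0∞`) form — and `gaussianMass_diff_ball_le_holds` — the `c = 1` case
  `ρ_s(L ∖ s √n B) ≤ 2⁻ⁿ ρ_s(L)`, via `√(2πe) e^{-π} ≤ 1/2` (`sqrt_two_pi_e_mul_exp_neg_pi_le`) —
  through the bridges `gaussianMass_coe_eq_ofReal_tsum`, `gaussianMass_diff_ball_eq_ofReal_tsum`
  between `gaussianMass` and real series over the lattice. The facts assume no measurable
  structure on the space; the proofs `borelize` (Poisson summation needs the Borel volume).

## Proof of the tail bound (Banaszczyk; Micciancio–Regev's presentation)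

With `t = c√(2π)` (so `t ≥ 1` iff `c ≥ 1/√(2π)`): on the tail `‖y - x‖ ≥ c s √n` one has
`ρ_s(y - x) = ρ_{ts}(y - x) e^{-π‖y-x‖²(1 - 1/t²)/s²} ≤ e^{-πc²n(1 - 1/t²)} ρ_{ts}(y - x)`; summing
and using `ρ_{ts}(L - x) ≤ tⁿ ρ_s(L)` (`tsum_gaussianFunction_sub_le_pow_mul`) gives the bound
with constant `tⁿ e^{-πc²n(1 - 1/t²)} = (c√(2π) e^{1/2} e^{-πc²})ⁿ = (c√(2πe) e^{-πc²})ⁿ`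
(`banaszczykConst_eq`).

## References

* W. Banaszczyk, *New bounds in some transference theorems in the geometry of numbers*,
  Math. Ann. 296 (1993) 625–635, Lemma 1.5.
* D. Aharonov, O. Regev, *Lattice problems in NP ∩ coNP*, J. ACM 52 (2005) 749–765, Lemma 2.5 and
  Lemma 3.1 (pp. 7–8 of the preprint, `lit read paper:doi-10-1109-focs-2004-35`).
* D. Micciancio, O. Regev, *Worst-case to average-case reductions based on Gaussian measures*,
  SIAM J. Comput. 37 (2007), Lemma 2.10.
-/

noncomputable section

open MeasureTheory Complex Module
open scoped Real FourierTransform InnerProductSpace ENNReal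

namespace Literature.Algebra.EuclideanLattices

variable {V : Type*} [NormedAddCommGroup V] [InnerProductSpace ℝ V] [FiniteDimensional ℝ V]
  [MeasurableSpace V] [BorelSpace V]

variable (L : Submodule ℤ V) [DiscreteTopology L] [IsZLattice ℝ L]

/-! ### Banaszczyk's tail bound (Lemma 1.5) and Aharonov–Regev Lemma 3.1 -/

/-- The constant of Banaszczyk's Lemma 1.5: `C(c) = c √(2πe) e^{-πc²}` equals
`e^{-πc²(1 - 1/(2πc²))} (c√(2π))` — the value of `tⁿ e^{-π c² n (1 - 1/t²)}` at the optimal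
`t = c√(2π)`, per dimension. [cite: Banaszczyk1993, Lemma 1.5] -/
theorem banaszczykConst_eq {c : ℝ} (hc : 0 < c) :
    c * Real.sqrt (2 * π * Real.exp 1) * Real.exp (-π * c ^ 2) =
      (c * Real.sqrt (2 * π)) * Real.exp (-(π * c ^ 2) * (1 - 1 / (c * Real.sqrt (2 * π)) ^ 2)) := by
  have h2π : 0 < 2 * π := by positivity
  have hsq : (c * Real.sqrt (2 * π)) ^ 2 = 2 * π * c ^ 2 := by
    rw [mul_pow, Real.sq_sqrt h2π.le]; ring
  rw [hsq]
  have hexp : -(π * c ^ 2) * (1 - 1 / (2 * π * c ^ 2)) = -π * c ^ 2 + 1 / 2 := by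
    field_simp
    ring
  have hsqrt : Real.sqrt (Real.exp 1) = Real.exp (1 / 2) := by
    have : Real.exp 1 = Real.exp (1 / 2) * Real.exp (1 / 2) := by
      rw [← Real.exp_add]
      norm_num
    rw [this, Real.sqrt_mul_self (Real.exp_pos _).le]
  rw [hexp, Real.exp_add, Real.sqrt_mul h2π.le, hsqrt]
  ring

/-- **Banaszczyk 1993, Lemma 1.5 (shifted tail bound)**: for a full lattice `L` in an
`n`-dimensional euclidean space, `s > 0`, `c ≥ 1/√(2π)` and any `x`,
`∑_{y ∈ L, ‖y - x‖ ≥ c s √n} ρ_s(y - x) ≤ (c√(2πe) e^{-πc²})ⁿ ρ_s(L)` (Banaszczyk's (ii), stated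
relative to `ρ_s(L)`, has an extra factor `2`; Aharonov–Regev 2005, Lemma 2.5; Micciancio–Regev
2007, Lemma 2.10). Proof: with `t = c√(2π) ≥ 1`, on the tail
`ρ_s(y - x) ≤ e^{-πc²n(1 - 1/t²)} ρ_{ts}(y - x)`, and `ρ_{ts}(L - x) ≤ tⁿ ρ_s(L)`
(`tsum_gaussianFunction_sub_le_pow_mul`); `tⁿ e^{-πc²n(1 - 1/t²)} = (c√(2πe) e^{-πc²})ⁿ`.
[cite: Banaszczyk1993, Lemma 1.5] -/
theorem tsum_indicator_gaussianFunction_sub_le {s c : ℝ} (hs : 0 < s) (hc : 1 / Real.sqrt (2 * π) ≤ c) (x : V) :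
    ∑' y : L, {y : L | c * s * Real.sqrt (finrank ℝ V) ≤ ‖(y : V) - x‖}.indicator
        (fun y ↦ gaussianFunction s ((y : V) - x)) y ≤
      (c * Real.sqrt (2 * π * Real.exp 1) * Real.exp (-π * c ^ 2)) ^ finrank ℝ V *
        ∑' y : L, gaussianFunction s (y : V) := by
  set n : ℕ := finrank ℝ V with hn
  have h2π : 0 < Real.sqrt (2 * π) := Real.sqrt_pos.2 (by positivity)
  have hc0 : 0 < c := lt_of_lt_of_le (by positivity) hc
  set t : ℝ := c * Real.sqrt (2 * π) with ht
  have ht1 : 1 ≤ t := by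
    rw [ht]
    have := mul_le_mul_of_nonneg_right hc h2π.le
    rwa [one_div, inv_mul_cancel₀ h2π.ne'] at this
  have ht0 : 0 < t := one_pos.trans_le ht1
  set K : ℝ := Real.exp (-(π * c ^ 2) * (1 - 1 / t ^ 2)) with hK
  have hK0 : 0 < K := Real.exp_pos _
  have h1t : 0 ≤ 1 - 1 / t ^ 2 := by
    rw [sub_nonneg, div_le_one (by positivity)]
    nlinarith
  -- pointwise bound on the tail
  have hpt : ∀ y : L, {y : L | c * s * Real.sqrt n ≤ ‖(y : V) - x‖}.indicator
      (fun y ↦ gaussianFunction s ((y : V) - x)) y ≤ K ^ n * gaussianFunction (t * s) ((y : V) - x) := by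
    intro y
    by_cases hy : c * s * Real.sqrt n ≤ ‖(y : V) - x‖
    · rw [Set.indicator_of_mem (show y ∈ {y : L | c * s * Real.sqrt n ≤ ‖(y : V) - x‖} from hy)]
      simp only [gaussianFunction]
      rw [hK, ← Real.exp_nat_mul, ← Real.exp_add]
      refine Real.exp_le_exp.2 ?_
      set r : ℝ := ‖(y : V) - x‖ with hr
      -- `R = r²/s² ≥ c² n`
      have hr2 : c ^ 2 * n ≤ r ^ 2 / s ^ 2 := by
        have h0 : 0 ≤ c * s * Real.sqrt n := by positivity
        rw [le_div_iff₀ (by positivity)]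
        calc c ^ 2 * n * s ^ 2 = (c * s * Real.sqrt n) ^ 2 := by
              rw [mul_pow, mul_pow, Real.sq_sqrt (Nat.cast_nonneg _)]; ring
          _ ≤ r ^ 2 := by rw [hr]; exact pow_le_pow_left₀ h0 hy 2
      have hint : 0 ≤ (1 - 1 / t ^ 2) * (π * (r ^ 2 / s ^ 2 - c ^ 2 * n)) :=
        mul_nonneg h1t (mul_nonneg Real.pi_pos.le (sub_nonneg.2 hr2))
      have hid : (n : ℝ) * (-(π * c ^ 2) * (1 - 1 / t ^ 2)) + -π * r ^ 2 / (t * s) ^ 2 =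
          -π * r ^ 2 / s ^ 2 + (1 - 1 / t ^ 2) * (π * (r ^ 2 / s ^ 2 - c ^ 2 * n)) := by
        have htne : t ^ 2 ≠ 0 := by positivity
        have hsne : s ^ 2 ≠ 0 := by positivity
        field_simp
        ring
      rw [hid]
      linarith
    · rw [Set.indicator_of_notMem (show y ∉ {y : L | c * s * Real.sqrt n ≤ ‖(y : V) - x‖} from hy)]
      exact (mul_pos (pow_pos hK0 _) (gaussianFunction_pos _ _)).le
  have hSt := summable_gaussianFunction_sub L (mul_pos ht0 hs).ne' x
  calc ∑' y : L, {y : L | c * s * Real.sqrt n ≤ ‖(y : V) - x‖}.indicator (fun y ↦ gaussianFunction s ((y : V) - x)) y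
      ≤ ∑' y : L, K ^ n * gaussianFunction (t * s) ((y : V) - x) := by
        refine Summable.tsum_le_tsum hpt ?_ (hSt.mul_left _)
        exact Summable.of_nonneg_of_le (fun y ↦ Set.indicator_nonneg (fun _ _ ↦ (gaussianFunction_pos _ _).le) _)
          hpt (hSt.mul_left _)
    _ = K ^ n * ∑' y : L, gaussianFunction (t * s) ((y : V) - x) := tsum_mul_left
    _ ≤ K ^ n * (t ^ n * ∑' y : L, gaussianFunction s (y : V)) :=
        mul_le_mul_of_nonneg_left (tsum_gaussianFunction_sub_le_pow_mul L hs ht1 x) (pow_nonneg hK0.le _)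
    _ = (c * Real.sqrt (2 * π * Real.exp 1) * Real.exp (-π * c ^ 2)) ^ n * ∑' y : L, gaussianFunction s (y : V) := by
        rw [banaszczykConst_eq hc0, ← ht, ← hK, mul_pow]
        ring

/-- **Banaszczyk's tail bound at the origin** (Lemma 1.5(i); Micciancio–Regev 2007, Lemma 2.10):
`∑_{y ∈ L, ‖y‖ ≥ c s √n} ρ_s(y) ≤ (c√(2πe) e^{-πc²})ⁿ ρ_s(L)` for `s > 0`, `c ≥ 1/√(2π)`.
[cite: Banaszczyk1993, Lemma 1.5] -/
theorem tsum_indicator_gaussianFunction_le {s c : ℝ} (hs : 0 < s) (hc : 1 / Real.sqrt (2 * π) ≤ c) :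
    ∑' y : L, {y : L | c * s * Real.sqrt (finrank ℝ V) ≤ ‖(y : V)‖}.indicator (fun y ↦ gaussianFunction s (y : V)) y ≤
      (c * Real.sqrt (2 * π * Real.exp 1) * Real.exp (-π * c ^ 2)) ^ finrank ℝ V *
        ∑' y : L, gaussianFunction s (y : V) := by
  have h := tsum_indicator_gaussianFunction_sub_le L hs hc 0
  simp only [sub_zero] at h
  exact h

/-- **Aharonov–Regev 2005, Lemma 3.1** (for every parameter `s > 0`): if `dist(x, L) ≥ c s √n`
with `c ≥ 1/√(2π)` then `ρ_s(L - x) ≤ (c√(2πe) e^{-πc²})ⁿ ρ_s(L)`, i.e.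
`f(x) = ρ(L - x)/ρ(L) ≤ 2^{-Ω(n)}` for `c > 1/√(2π)` (where the base `c√(2πe) e^{-πc²}` is `< 1`);
"the proof follows trivially from Lemma 2.5" (Banaszczyk's tail bound: every lattice point is in
the tail). [cite: AharonovRegev2005, Lemma 3.1 (p. 8)] -/
theorem tsum_gaussianFunction_sub_le_pow_mul_of_forall_le {s c : ℝ} (hs : 0 < s)
    (hc : 1 / Real.sqrt (2 * π) ≤ c) {x : V} (hx : ∀ y : L, c * s * Real.sqrt (finrank ℝ V) ≤ ‖(y : V) - x‖) :
    ∑' y : L, gaussianFunction s ((y : V) - x) ≤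
      (c * Real.sqrt (2 * π * Real.exp 1) * Real.exp (-π * c ^ 2)) ^ finrank ℝ V *
        ∑' y : L, gaussianFunction s (y : V) := by
  have h := tsum_indicator_gaussianFunction_sub_le L hs hc x
  have heq : ∀ y : L, {y : L | c * s * Real.sqrt (finrank ℝ V) ≤ ‖(y : V) - x‖}.indicator
      (fun y ↦ gaussianFunction s ((y : V) - x)) y = gaussianFunction s ((y : V) - x) := fun y ↦
    Set.indicator_of_mem (s := {y : L | c * s * Real.sqrt (finrank ℝ V) ≤ ‖(y : V) - x‖}) (hx y) _
  simp only [heq] at h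
  exact h

/-! ### Bridge to `gaussianMass` and discharge of `gaussianMass_diff_ball_le_pow_mul` -/

omit [MeasurableSpace V] [BorelSpace V] in
/-- The Gaussian mass of a lattice as a real series: `ρ_{s,c}(Λ) = ofReal (∑_{y ∈ Λ} ρ_s(y - c))`.
[cite: MicciancioRegev2007, §2] -/
theorem gaussianMass_coe_eq_ofReal_tsum (Λ : Submodule ℤ V) [DiscreteTopology Λ] {s : ℝ} (hs : s ≠ 0) (c : V) :
    gaussianMass s c (Λ : Set V) = ENNReal.ofReal (∑' y : Λ, gaussianFunction s ((y : V) - c)) := by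
  rw [ENNReal.ofReal_tsum_of_nonneg (fun _ ↦ (gaussianFunction_pos _ _).le) (summable_gaussianFunction_sub Λ hs c)]
  rfl

omit [MeasurableSpace V] [BorelSpace V] in
/-- The Gaussian mass of the lattice points outside a ball, as a real series with an indicator.
[cite: MicciancioRegev2007, §2] -/
theorem gaussianMass_diff_ball_eq_ofReal_tsum (Λ : Submodule ℤ V) [DiscreteTopology Λ] {s : ℝ} (hs : s ≠ 0)
    (r : ℝ) :
    gaussianMass s 0 ((Λ : Set V) \ Metric.ball (0 : V) r) =
      ENNReal.ofReal (∑' y : Λ, {y : Λ | r ≤ ‖(y : V)‖}.indicator (fun y ↦ gaussianFunction s (y : V)) y) := by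
  have hsum : Summable fun y : Λ ↦ {y : Λ | r ≤ ‖(y : V)‖}.indicator (fun y ↦ gaussianFunction s (y : V)) y := by
    refine Summable.of_nonneg_of_le (fun y ↦ Set.indicator_nonneg (fun _ _ ↦ (gaussianFunction_pos _ _).le) _)
      (fun y ↦ Set.indicator_le_self' (fun _ _ ↦ (gaussianFunction_pos _ _).le) y) ?_
    exact (summable_gaussianFunction_sub Λ hs 0).congr fun y ↦ by rw [sub_zero]
  rw [ENNReal.ofReal_tsum_of_nonneg (fun _ ↦ Set.indicator_nonneg (fun _ _ ↦ (gaussianFunction_pos _ _).le) _)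
    hsum, gaussianMass,
    tsum_subtype ((Λ : Set V) \ Metric.ball (0 : V) r) (fun x : V ↦ ENNReal.ofReal (gaussianFunction s (x - 0)))]
  have hind : ∀ x : V, ((Λ : Set V) \ Metric.ball (0 : V) r).indicator
      (fun x : V ↦ ENNReal.ofReal (gaussianFunction s (x - 0))) x =
      (Λ : Set V).indicator ((Metric.ball (0 : V) r)ᶜ.indicator
        fun x : V ↦ ENNReal.ofReal (gaussianFunction s (x - 0))) x := by
    intro x
    rw [Set.sdiff_eq, Set.indicator_indicator]
  simp_rw [hind]
  rw [← tsum_subtype (Λ : Set V) ((Metric.ball (0 : V) r)ᶜ.indicator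
    fun x : V ↦ ENNReal.ofReal (gaussianFunction s (x - 0)))]
  refine tsum_congr fun y ↦ ?_
  simp only [Set.indicator, Set.mem_compl_iff, Metric.mem_ball, dist_zero_right, not_lt, Set.mem_setOf_eq,
    sub_zero]
  split_ifs <;> simp

/-- **Discharge of `gaussianMass_diff_ball_le_pow_mul`** (Banaszczyk 1993, Lemma 1.5(i), scaled form
of Micciancio–Regev 2007, Lemma 2.10): `ρ_s(L ∖ c s √n B) ≤ (c√(2πe) e^{-πc²})ⁿ ρ_s(L)` for
`s > 0`, `c ≥ 1/√(2π)`. The fact is stated without a measurable structure on the space; the proof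
(Poisson summation) runs after `borelize`. [cite: Banaszczyk1993, Lemma 1.5] -/
theorem gaussianMass_diff_ball_le_pow_mul_holds {E : Type*} [NormedAddCommGroup E] [InnerProductSpace ℝ E]
    (Λ : Submodule ℤ E) [FiniteDimensional ℝ E] [DiscreteTopology Λ] [IsZLattice ℝ Λ] :
    gaussianMass_diff_ball_le_pow_mul Λ := by
  intro s a hs ha
  borelize E
  have ha0 : 0 < a := lt_of_lt_of_le (by positivity) ha
  rw [gaussianMass_diff_ball_eq_ofReal_tsum Λ hs.ne', gaussianMass_coe_eq_ofReal_tsum Λ hs.ne' 0,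
    ← ENNReal.ofReal_mul (by positivity)]
  simp_rw [sub_zero]
  exact ENNReal.ofReal_le_ofReal (tsum_indicator_gaussianFunction_le Λ hs ha)

/-- The numerical fact behind Micciancio–Regev 2007, Lemma 2.10: `√(2πe) e^{-π} ≤ 1/2` (indeed
`< 1/4`: `√(2πe) < 5` and `e^{-π} < e^{-3} < 1/20`). [cite: MicciancioRegev2007, Lemma 2.10] -/
theorem sqrt_two_pi_e_mul_exp_neg_pi_le : Real.sqrt (2 * π * Real.exp 1) * Real.exp (-π) ≤ 2⁻¹ := by
  have hπ := Real.pi_lt_d2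
  have hπ' := Real.pi_gt_d2
  have he := Real.exp_one_lt_d9
  have he' := Real.exp_one_gt_d9
  have h1 : Real.sqrt (2 * π * Real.exp 1) ≤ 5 := by
    rw [Real.sqrt_le_left (by norm_num)]
    nlinarith
  have h2 : Real.exp (-π) ≤ 1 / 20 := by
    rw [Real.exp_neg, inv_eq_one_div, div_le_div_iff_of_pos_left one_pos (Real.exp_pos _) (by norm_num)]
    have h3 : Real.exp 3 ≤ Real.exp π := Real.exp_le_exp.2 (by linarith)
    have h4 : (20 : ℝ) ≤ Real.exp 3 := by
      rw [show (3 : ℝ) = 1 + 1 + 1 by norm_num, Real.exp_add, Real.exp_add]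
      nlinarith [Real.exp_pos 1]
    linarith
  calc Real.sqrt (2 * π * Real.exp 1) * Real.exp (-π) ≤ 5 * (1 / 20) := by
        gcongr
    _ ≤ 2⁻¹ := by norm_num

/-- **Discharge of `gaussianMass_diff_ball_le`** (Micciancio–Regev 2007, Lemma 2.10; Banaszczyk 1993,
Lemma 1.5(i) with `c = 1`): `ρ_s(L ∖ s √n B) ≤ 2⁻ⁿ ρ_s(L)` for `s > 0`.
[cite: MicciancioRegev2007, Lemma 2.10] -/
theorem gaussianMass_diff_ball_le_holds {E : Type*} [NormedAddCommGroup E] [InnerProductSpace ℝ E]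
    (Λ : Submodule ℤ E) [FiniteDimensional ℝ E] [DiscreteTopology Λ] [IsZLattice ℝ Λ] :
    gaussianMass_diff_ball_le Λ := by
  intro s hs
  have h1 : 1 / Real.sqrt (2 * π) ≤ 1 := by
    rw [div_le_one (Real.sqrt_pos.2 (by positivity))]
    exact Real.one_le_sqrt.2 (by linarith [Real.pi_gt_three])
  have h := gaussianMass_diff_ball_le_pow_mul_holds Λ hs h1
  rw [one_mul] at h
  have hC : ENNReal.ofReal ((1 * Real.sqrt (2 * π * Real.exp 1) * Real.exp (-π * 1 ^ 2)) ^ finrank ℝ E) ≤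
      (2⁻¹ : ℝ≥0∞) ^ finrank ℝ E := by
    rw [one_pow, mul_one, one_mul, ENNReal.ofReal_pow (by positivity), show (2⁻¹ : ℝ≥0∞) = ENNReal.ofReal 2⁻¹ by
      rw [ENNReal.ofReal_inv_of_pos two_pos, ENNReal.ofReal_ofNat]]
    exact pow_le_pow_left' (ENNReal.ofReal_le_ofReal sqrt_two_pi_e_mul_exp_neg_pi_le) _
  calc _ ≤ _ := h
    _ ≤ (2⁻¹ : ℝ≥0∞) ^ finrank ℝ E * gaussianMass s 0 (Λ : Set E) := by gcongr

end Literature.Algebra.EuclideanLattices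

end
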